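/-
Copyright (c) 2026 the pub-hodgecm-mathlib formalisation cell (harness21).  Prover seat hodgecm-mathlib-LH4-p08 (g7), req620 Track A «(D-RAM) FOUR-FRAME» squad, helper lane
on h413 = stmt-HodgeConjecture-24833 (count-neutral).  STAGE-1b typed inventory (heir LEAD F0P3a-plan (g20) T19-24): row (3) G-side for the four frozen pieces `gselStar`.  2026-09-04.
-/
import Summits.HodgeConjecture.HodgeConjecture.Theorems.F0P3cDyRamPiecePropsGselStar            -- ★ p854876 «PAYER-T0-PP» (LH4-p12 (g0)): `piecePropsWild_gselStar : PiecePropsWild mstarFn gselStar` (smooth, K-supported, `Ad K`, left `K(ϖ^{m*})`)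
import Literature.NumberTheory.Rogawski1990.LocalDeltaTransferLeviStratumPieceNearOne               -- ★ (this seat): `exists_nhds_one_finsum_delta_mul_integral_eq_of_levi_of_level`
import HarnessLib

/-!
# Crux `H413`, line LH4 «(D-RAM) FOUR-FRAME» — ROW (3) G-SIDE FOR THE FOUR FROZEN PIECES: near `1` on the Levi population the `Δ`-weighted class sums of `gselStar j` and
# `gselStar j′` are proportional in the ratio of their unipotent-fibre volumes (division-free)

Cell `hodgecm-mathlib` (D-0151), FLOOR 0, crux item H413 = `stmt-HodgeConjecture-24833`, route of record `HCCMUnconditional`; squad F0∕P3c∕LH4 (req618∕req620); helper lane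
`--supports stmt-HodgeConjecture-24833 --as helper` (count-neutral).  THEOREMS ONLY (no `def`, no instance, no notation, no `sorry`, default heartbeats).

WHAT.  The tier-0 rows `F0P3cDyRamFourFrame.stub_rows_transvPlus ∕ …transvMinus ∕ …regular : PieceRowsWild gselStar j` (`j = 1, 2, 3`) each contain ROW (3): near `1 ∈ H_v`, for
`G`-regular `γ_H` `H_v`-conjugate to a diagonal, `Σᶠ_c Δ‴_v[μ](γ_H, out c)·Φ(c, gselStar j) = Σ_s a_s Φ^st(γ_H, ψ_s)`.  This file delivers its `G`-SIDE relative to the anchor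
`gselStar 0 = 1_K` (whose row (3) is ★ p855650 `exists_nhds_one_finsum_delta_indicator_eq_mul_stableOrbitalIntegralRel_hFamily_zero_of_levi`): for ALL `j, j′ : Fin 4`, ANY local
transfer factor `T` on the quasi-split `U(Φ₃)`, ANY Haar `νG₃` with a canonical family `mG₃`, ANY s-finite Haar `μ_N` on `N(L⁺_v)`,
`∃ V ∈ 𝓝 1, ∀ γ_H ∈ V` Levi and `G`-regular: `(Σᶠ_c T.Δ γ_H (out c)·Φ(c, gselStar j))·∫_N gselStar j′ = (Σᶠ_c T.Δ γ_H (out c)·Φ(c, gselStar j′))·∫_N gselStar j` — ★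
`exists_nhds_one_finsum_delta_mul_integral_eq_of_levi_of_level` at `M := mstarFn L v w`, its four invariance hypotheses being the `Ad K` and left-`K(ϖ_w^{m*})` clauses of ★
`piecePropsWild_gselStar` and measurability from smoothness (`IsLocSmooth.continuous`).  So on the Levi population every piece is the unit times its fibre-volume fraction
`ρ_j = ∫_N gselStar j ∕ μ_N(N ∩ K)`; what remains of row (3) per piece is ONE elementary fibre-volume evaluation and the H-side scalar condition (LH4-p08 (g7) PRESCOPE v3 §7∕§8).

* `exists_nhds_one_finsum_delta_gselStar_mul_integral_eq_of_levi` — the statement above.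
HONEST LABEL.  Count-neutral (`--supports`): composition BY NAME over ★ only; pays no registered stub and touches no `Lines/` module; the three tier-0 rows stay OPEN;
`HC_CM` is proved only modulo the 7 printed citations (2 remaining named inputs: hLiu418 = `stmt-HodgeConjecture-24832`, h413 = `stmt-HodgeConjecture-24833`) until rung 0 closes.

## References
* [Rogawski1990] J. D. Rogawski, *Automorphic Representations of Unitary Groups in Three Variables*, Ann. of Math. Stud. 123 (1990): §4.9 Prop. 4.9.1 (b) p. 55, Lemma 4.9.2
  p. 56; §4.3 (4.3.1) p. 43; §3.5 Prop. 3.5.2 pp. 25–26.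
* [Kottwitz1986] R. E. Kottwitz, *Base change for unit elements of Hecke algebras*, Compositio Math. 60 (1986): §7.
-/

set_option autoImplicit false

noncomputable section

namespace Summit.HodgeConjecture.HodgeConjecture.Cruxes.H413.F0P3cDyRamPieceLeviKappaSum

open MeasureTheory Measure NumberField IsDedekindDomain Topology Filter
open Literature.NumberTheory.Automorphic Literature.NumberTheory.Automorphic.UnitaryGroup Literature.NumberTheory.Automorphic.IntegralReduction
open Literature.NumberTheory.Rogawski1990 Literature.NumberTheory.GaloisRepresentations
open scoped Matrix MatrixGroups Classical ValuativeRel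
open Summit.HodgeConjecture.HodgeConjecture.Cruxes.H413.F0P3cDyRamFourFramePieces
open Summit.HodgeConjecture.HodgeConjecture.Cruxes.H413.F0P3cDyRamPiecePropsGselStar

/-- **ROW (3) `G`-SIDE FOR THE FOUR FROZEN PIECES `gselStar = (1_K, f_{T+}, f_{T−}, f_reg)`.**  At a wild ramified non-split CM place (`PieceRowsWild`'s place binders), for ANY
local transfer factor `T` on `U(Φ₃)`, ANY Haar `νG₃` with CANONICAL `mG₃`, ANY s-finite Haar `μ_N` on `N(L⁺_v)` (Borel structure on the `unitaryGroupOfForm` spelling) and all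
`j, j′ : Fin 4`: near `1 ∈ H_v`, for every `γ_H` that is `H_v`-conjugate to a diagonal and `G`-regular,
`(Σᶠ_c T.Δ γ_H (out c)·Φ(c, gselStar j))·∫_N gselStar j′ = (Σᶠ_c T.Δ γ_H (out c)·Φ(c, gselStar j′))·∫_N gselStar j`.
[cite: Rogawski1990, §4.9 Prop. 4.9.1 (b) p. 55, Lemma 4.9.2 p. 56; §4.3 (4.3.1) p. 43; §3.5 Prop. 3.5.2 pp. 25–26] [cite: Kottwitz1986, §7] -/
theorem exists_nhds_one_finsum_delta_gselStar_mul_integral_eq_of_levi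
    (L : Type) [Field L] [NumberField L] [IsCMField L]
    {v : HeightOneSpectrum (𝓞 ↥(maximalRealSubfield L))} (w : UnitaryGroup.PlacesOver L v)
    (hw : IsCMField.complexConj L • w.1 = w.1) (he : v.asIdeal.ramificationIdx' w.1.asIdeal ≠ 1)
    (h2 : ¬ IsUnit (2 : 𝒪[w.1.adicCompletion L]))
    (ϖ : (w.1.adicCompletion L)) (hϖ : Valued.v ϖ = WithZero.exp (-1 : ℤ))
    [MeasurableSpace ((UnitaryGroup.cmDatum L 3 (Matrix.of fun i j : Fin 3 => if i.val + j.val + 1 = 3 then (1 : L) else 0)).Local v)] [BorelSpace ((UnitaryGroup.cmDatum L 3 (Matrix.of fun i j : Fin 3 => if i.val + j.val + 1 = 3 then (1 : L) else 0)).Local v)]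
    [∀ γ : ((UnitaryGroup.cmDatum L 3 (Matrix.of fun i j : Fin 3 => if i.val + j.val + 1 = 3 then (1 : L) else 0)).Local v), MeasurableSpace (((UnitaryGroup.cmDatum L 3 (Matrix.of fun i j : Fin 3 => if i.val + j.val + 1 = 3 then (1 : L) else 0)).Local v) ⧸ Subgroup.centralizer ({γ} : Set ((UnitaryGroup.cmDatum L 3 (Matrix.of fun i j : Fin 3 => if i.val + j.val + 1 = 3 then (1 : L) else 0)).Local v)))]
    [∀ γ : ((UnitaryGroup.cmDatum L 3 (Matrix.of fun i j : Fin 3 => if i.val + j.val + 1 = 3 then (1 : L) else 0)).Local v), BorelSpace (((UnitaryGroup.cmDatum L 3 (Matrix.of fun i j : Fin 3 => if i.val + j.val + 1 = 3 then (1 : L) else 0)).Local v) ⧸ Subgroup.centralizer ({γ} : Set ((UnitaryGroup.cmDatum L 3 (Matrix.of fun i j : Fin 3 => if i.val + j.val + 1 = 3 then (1 : L) else 0)).Local v)))]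
    (νG₃ : Measure ((UnitaryGroup.cmDatum L 3 (Matrix.of fun i j : Fin 3 => if i.val + j.val + 1 = 3 then (1 : L) else 0)).Local v)) [νG₃.IsHaarMeasure] [νG₃.IsMulRightInvariant]
    {mG₃ : OrbitalMeasureFamily ((UnitaryGroup.cmDatum L 3 (Matrix.of fun i j : Fin 3 => if i.val + j.val + 1 = 3 then (1 : L) else 0)).Local v)}
    (hmG : mG₃.IsCanonical (fun γ => IsRegularElt (γ.val : GL (Fin 3) (UnitaryGroup.LocalRing L v))) νG₃)
    [MeasurableSpace ↥(unitaryGroupOfForm (conjLocal L (IsCMField.complexConj L) v) (cmLocalForm L 3 v))] [BorelSpace ↥(unitaryGroupOfForm (conjLocal L (IsCMField.complexConj L) v) (cmLocalForm L 3 v))]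
    (μN : Measure ↥(unipotentU (conjLocal L (IsCMField.complexConj L) v) (cmLocalForm L 3 v))) [μN.IsHaarMeasure] [SFinite μN]
    (T : LocalTransferFactor L (Matrix.of fun i j : Fin 3 => if i.val + j.val + 1 = 3 then (1 : L) else 0) v) (j j' : Fin 4) :
    ∃ V ∈ 𝓝 (1 : ((UnitaryGroup.cmDatum L 2 (Matrix.of fun i j : Fin 2 => if i.val + j.val + 1 = 2 then (1 : L) else 0)).Local v × (UnitaryGroup.cmDatum L 1 (Matrix.of fun i j : Fin 1 => if i.val + j.val + 1 = 1 then (1 : L) else 0)).Local v)),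
      ∀ γH ∈ V,
        (∃ (y : ((UnitaryGroup.cmDatum L 2 (Matrix.of fun i j : Fin 2 => if i.val + j.val + 1 = 2 then (1 : L) else 0)).Local v × (UnitaryGroup.cmDatum L 1 (Matrix.of fun i j : Fin 1 => if i.val + j.val + 1 = 1 then (1 : L) else 0)).Local v)) (d' : Fin 2 → (UnitaryGroup.LocalRing L v)ˣ),
            glDiagonal 2 (UnitaryGroup.LocalRing L v) d' = ((y * γH * y⁻¹).1.val : GL (Fin 2) (UnitaryGroup.LocalRing L v))) →
        IsLocalGRegular L v γH →
          (∑ᶠ c : ConjClasses ((UnitaryGroup.cmDatum L 3 (Matrix.of fun i j : Fin 3 => if i.val + j.val + 1 = 3 then (1 : L) else 0)).Local v), T.Δ γH (Quotient.out c) * classOrbitalIntegral mG₃ ((gselStar j) L v w hw ϖ) c) *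
              ∫ n : ↥(unipotentU (conjLocal L (IsCMField.complexConj L) v) (cmLocalForm L 3 v)), (gselStar j') L v w hw ϖ ((n : ↥(unitaryGroupOfForm (conjLocal L (IsCMField.complexConj L) v) (cmLocalForm L 3 v))) : ((UnitaryGroup.cmDatum L 3 (Matrix.of fun i j : Fin 3 => if i.val + j.val + 1 = 3 then (1 : L) else 0)).Local v)) ∂μN =
            (∑ᶠ c : ConjClasses ((UnitaryGroup.cmDatum L 3 (Matrix.of fun i j : Fin 3 => if i.val + j.val + 1 = 3 then (1 : L) else 0)).Local v), T.Δ γH (Quotient.out c) * classOrbitalIntegral mG₃ ((gselStar j') L v w hw ϖ) c) *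
              ∫ n : ↥(unipotentU (conjLocal L (IsCMField.complexConj L) v) (cmLocalForm L 3 v)), (gselStar j) L v w hw ϖ ((n : ↥(unitaryGroupOfForm (conjLocal L (IsCMField.complexConj L) v) (cmLocalForm L 3 v))) : ((UnitaryGroup.cmDatum L 3 (Matrix.of fun i j : Fin 3 => if i.val + j.val + 1 = 3 then (1 : L) else 0)).Local v)) ∂μN := by
  obtain ⟨hsm, -, hK, hM⟩ := piecePropsWild_gselStar L w hw he h2 ϖ hϖ j
  obtain ⟨hsm', -, hK', hM'⟩ := piecePropsWild_gselStar L w hw he h2 ϖ hϖ j'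
  exact exists_nhds_one_finsum_delta_mul_integral_eq_of_levi_of_level L w hw ϖ hϖ (mstarFn L v w) νG₃ hmG μN T
    hsm.continuous.measurable hsm'.continuous.measurable hK hK' hM hM'

end Summit.HodgeConjecture.HodgeConjecture.Cruxes.H413.F0P3cDyRamPieceLeviKappaSum

end
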